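import Literature.Probability.Percolation.ArmSeparationInnerBound
import HarnessLib

/-!
# Inner separation of two arms in the six axis-compatible frames

Topic: Probability / Percolation; family `crit-perc`. A brick of the discharge of
`Literature.Probability.Percolation.Nolin2008_twoArm_separation` (Nolin 2008, Thm. 11
[arXiv 0711.4948: Thm. 10], `j = 2`, `σ = BW`; `ArmSeparation.lean`), internal extremities.
`ArmSeparationInner.lean` fences the inner tips of the two arms in the rotated frames
`rotConfig i` (`i < 6`). For the inward EXTENSION of the fenced arms by RSW corridors (which are
parallelograms with sides along the coordinate axes `e₀, e₁` of `Site 2`), the frame of a tip must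
carry axis-parallel boxes to objects that axis-parallel crossings can meet: this holds for the
identity (side `x₀ = m` of `∂Λ_m`), the rotation `ρ` (side `x₀ + x₁ = m`), the transposition
`σ(x₀, x₁) = (x₁, x₀)` (side `x₁ = m`), `-id` (side `x₀ = -m`), `ρ⁴ = -ρ` (side `x₀ + x₁ = -m`) and
`-σ` (side `x₁ = -m`), but not for `ρ²`, `ρ⁵`. This file redoes the two-arm statements of
`ArmSeparationInner.lean` / `ArmSeparationInnerBound.lean` for this family of frames, and for
general two-arm data (arbitrary arm regions, as needed for arms already landed on `∂Λ_N`):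

* `frameIso i` (`i < 6`) — the six lattice automorphisms above; coordinate formulas, norm
  invariance; `frameConfig i ω = {v | frameIso i v ∈ ω}` with `P_{1/2}`-invariance
  (`real_preimage_frameConfig`) and transport of paths (`pathIn_frameConfig`,
  `pathIn_of_frameConfig`); every site lies on the right side in some frame
  (`exists_frame_symm_apply_zero_eq`);
* `InGoodF` — nothing fails in the twelve framed / colour-exchanged configurations, with
  `real_not_inGoodF_le` (the bound of `real_not_inGood_le`, same proof);
* `exists_two_intFencedArm_frames` — two-arm data (an open path of a region `A_o` from `∂Λ_m` to
  beyond `Λ_{2m}`, a closed one of a region `A_c`) and `InGoodF` give fenced arms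
  `IntFencedArm` in some frames `io`, `ic`;
* `disjoint_intRegion_frames` — their interior regions, mapped back by `frameIso io`,
  `frameIso ic`, are disjoint (same frame: `int_compatible_same₂`; different frames: explicit
  coordinates).

## References

* P. Nolin, *Near-critical percolation in two dimensions*, Electron. J. Probab. 13 (2008), §4.2,
  §4.4 (proof of Thm. 11, internal extremities) [arXiv 0711.4948: Def. 6–8, Thm. 10]. [Nolin2008]
* H. Kesten, *Scaling relations for 2D-percolation*, Comm. Math. Phys. 109 (1987), Lemma 2. [Kesten1987]

Tree: `IntFencedArm`, `exists_intFencedArm_b_eq`, `InFail`, `InGuard`, `int_compatible_same₂`,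
`tip_bounds_of_guards` (`ArmSeparationInner.lean`); `inBad`, `real_inBad_le`
(`ArmSeparationInnerBound.lean`); `triRotIsoPow`, `rot_apply_formula`, `triRotIsoPow_add_apply`,
`triRotIsoPow_six_apply`, `triNorm_rot` (`ArmSeparationRotate.lean`, `TriAnnulusCircuit.lean`);
`triSwapIso`, `transposeIso_apply_zero/one`, `transposeIso_transposeIso` (`TriHexLemma.lean`,
`LatticeSymmetry.lean`); `triNegIso` (`TriRSWChaining.lean`); `SiteConfig.relabel` API,
`sitePercolation_real_preimage_relabel` (`SitePercolationMeasure.lean`); `pathIn_map_iso`.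
-/

noncomputable section

open MeasureTheory Set

namespace Literature.Probability.Percolation

open LatticeModels HalfAnnulus

/-! ### The six frames -/

/-- **The six axis-compatible frames**: `id`, `ρ`, `σ` (transposition), `-id`, `ρ⁴`, `-σ`
(`i ≥ 6`: `id`). In the frame `i` the side `frameIso i ({x₀ = m})` of `∂Λ_m` becomes the right
side. [cite: Nolin2008, §4.4 (arXiv 0711.4948: proof of Thm. 10)] -/
def frameIso : ℕ → (triGraph ≃g triGraph)
  | 0 => RelIso.refl _
  | 1 => triRotIsoPow 1
  | 2 => triSwapIso
  | 3 => triNegIso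
  | 4 => triRotIsoPow 4
  | 5 => triSwapIso.trans triNegIso
  | _ + 6 => RelIso.refl _

/-- Coordinates of `frameIso i v`, `i < 6`. [folklore] -/
theorem frameIso_apply_formula (v : Site 2) :
    (frameIso 0 v) 0 = v 0 ∧ (frameIso 0 v) 1 = v 1 ∧
    (frameIso 1 v) 0 = -v 1 ∧ (frameIso 1 v) 1 = v 0 + v 1 ∧
    (frameIso 2 v) 0 = v 1 ∧ (frameIso 2 v) 1 = v 0 ∧
    (frameIso 3 v) 0 = -v 0 ∧ (frameIso 3 v) 1 = -v 1 ∧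
    (frameIso 4 v) 0 = v 1 ∧ (frameIso 4 v) 1 = -(v 0 + v 1) ∧
    (frameIso 5 v) 0 = -v 1 ∧ (frameIso 5 v) 1 = -v 0 := by
  obtain ⟨-, -, h1a, h1b, -, -, -, -, h4a, h4b, -, -⟩ := rot_apply_formula v
  refine ⟨rfl, rfl, h1a, h1b, ?_, ?_, ?_, ?_, h4a, h4b, ?_, ?_⟩
  · show (triSwapIso v) 0 = v 1; rw [triSwapIso_apply, transposeIso_apply_zero]
  · show (triSwapIso v) 1 = v 0; rw [triSwapIso_apply, transposeIso_apply_one]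
  · show (triNegIso v) 0 = -v 0; rw [triNegIso_apply]; rfl
  · show (triNegIso v) 1 = -v 1; rw [triNegIso_apply]; rfl
  · show (triNegIso (triSwapIso v)) 0 = -v 1; rw [triNegIso_apply, triSwapIso_apply, Pi.neg_apply, transposeIso_apply_zero]
  · show (triNegIso (triSwapIso v)) 1 = -v 0; rw [triNegIso_apply, triSwapIso_apply, Pi.neg_apply, transposeIso_apply_one]

/-- Coordinates of `(frameIso i)⁻¹ y`, `i < 6` (the inverses are `id`, `ρ⁵`, `σ`, `-id`, `ρ²`, `-σ`). [folklore] -/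
theorem frameIso_symm_apply_formula (y : Site 2) :
    ((frameIso 0).symm y) 0 = y 0 ∧ ((frameIso 0).symm y) 1 = y 1 ∧
    ((frameIso 1).symm y) 0 = y 0 + y 1 ∧ ((frameIso 1).symm y) 1 = -y 0 ∧
    ((frameIso 2).symm y) 0 = y 1 ∧ ((frameIso 2).symm y) 1 = y 0 ∧
    ((frameIso 3).symm y) 0 = -y 0 ∧ ((frameIso 3).symm y) 1 = -y 1 ∧
    ((frameIso 4).symm y) 0 = -(y 0 + y 1) ∧ ((frameIso 4).symm y) 1 = y 0 ∧
    ((frameIso 5).symm y) 0 = -y 1 ∧ ((frameIso 5).symm y) 1 = -y 0 := by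
  -- each inverse is identified by checking `frameIso i w = y` on the candidate `w`
  have key : ∀ i : ℕ, ∀ w : Site 2, frameIso i w = y → (frameIso i).symm y = w := fun i w hw => by
    rw [← hw, RelIso.symm_apply_apply]
  have e1 : (frameIso 1).symm y = ![y 0 + y 1, -y 0] := key 1 _ (by
    obtain ⟨-, -, g1a, g1b, -⟩ := frameIso_apply_formula (![y 0 + y 1, -y 0] : Site 2)
    refine Site.eq_iff_two.2 ⟨?_, ?_⟩
    · rw [g1a, site_mk_apply_one]; ring
    · rw [g1b, site_mk_apply_zero, site_mk_apply_one]; ring)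
  have e2 : (frameIso 2).symm y = ![y 1, y 0] := key 2 _ (by
    obtain ⟨-, -, -, -, g2a, g2b, -⟩ := frameIso_apply_formula (![y 1, y 0] : Site 2)
    exact Site.eq_iff_two.2 ⟨by rw [g2a, site_mk_apply_one], by rw [g2b, site_mk_apply_zero]⟩)
  have e3 : (frameIso 3).symm y = ![-y 0, -y 1] := key 3 _ (by
    obtain ⟨-, -, -, -, -, -, g3a, g3b, -⟩ := frameIso_apply_formula (![-y 0, -y 1] : Site 2)
    exact Site.eq_iff_two.2 ⟨by rw [g3a, site_mk_apply_zero]; ring, by rw [g3b, site_mk_apply_one]; ring⟩)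
  have e4 : (frameIso 4).symm y = ![-(y 0 + y 1), y 0] := key 4 _ (by
    obtain ⟨-, -, -, -, -, -, -, -, g4a, g4b, -⟩ := frameIso_apply_formula (![-(y 0 + y 1), y 0] : Site 2)
    refine Site.eq_iff_two.2 ⟨?_, ?_⟩
    · rw [g4a, site_mk_apply_one]
    · rw [g4b, site_mk_apply_zero, site_mk_apply_one]; ring)
  have e5 : (frameIso 5).symm y = ![-y 1, -y 0] := key 5 _ (by
    obtain ⟨-, -, -, -, -, -, -, -, -, -, g5a, g5b⟩ := frameIso_apply_formula (![-y 1, -y 0] : Site 2)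
    exact Site.eq_iff_two.2 ⟨by rw [g5a, site_mk_apply_one]; ring, by rw [g5b, site_mk_apply_zero]; ring⟩)
  refine ⟨rfl, rfl, ?_, ?_, ?_, ?_, ?_, ?_, ?_, ?_, ?_, ?_⟩
  · rw [e1, site_mk_apply_zero]
  · rw [e1, site_mk_apply_one]
  · rw [e2, site_mk_apply_zero]
  · rw [e2, site_mk_apply_one]
  · rw [e3, site_mk_apply_zero]
  · rw [e3, site_mk_apply_one]
  · rw [e4, site_mk_apply_zero]
  · rw [e4, site_mk_apply_one]
  · rw [e5, site_mk_apply_zero]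
  · rw [e5, site_mk_apply_one]

/-- The frames are additive (linear): `frameIso i (v - w) = frameIso i v - frameIso i w`, `i < 6`. [folklore] -/
theorem frameIso_sub (i : ℕ) (hi : i < 6) (v w : Site 2) : frameIso i (v - w) = frameIso i v - frameIso i w := by
  obtain ⟨a0, a1, b0, b1, c0, c1, d0, d1, e0, e1, f0, f1⟩ := frameIso_apply_formula (v - w)
  obtain ⟨a0', a1', b0', b1', c0', c1', d0', d1', e0', e1', f0', f1'⟩ := frameIso_apply_formula v
  obtain ⟨a0'', a1'', b0'', b1'', c0'', c1'', d0'', d1'', e0'', e1'', f0'', f1''⟩ := frameIso_apply_formula w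
  simp only [Pi.sub_apply] at a0 a1 b0 b1 c0 c1 d0 d1 e0 e1 f0 f1
  refine Site.eq_iff_two.2 ⟨?_, ?_⟩ <;> rw [Pi.sub_apply]
  · interval_cases i
    · rw [a0, a0', a0'']
    · rw [b0, b0', b0'']; ring
    · rw [c0, c0', c0'']
    · rw [d0, d0', d0'']; ring
    · rw [e0, e0', e0'']
    · rw [f0, f0', f0'']; ring
  · interval_cases i
    · rw [a1, a1', a1'']
    · rw [b1, b1', b1'']; ring
    · rw [c1, c1', c1'']
    · rw [d1, d1', d1'']; ring
    · rw [e1, e1', e1'']; ring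
    · rw [f1, f1', f1'']; ring

/-- The inverse frames are additive: `(frameIso i)⁻¹ (v - w) = (frameIso i)⁻¹ v - (frameIso i)⁻¹ w`, `i < 6`. [folklore] -/
theorem frameIso_symm_sub (i : ℕ) (hi : i < 6) (v w : Site 2) :
    (frameIso i).symm (v - w) = (frameIso i).symm v - (frameIso i).symm w := by
  apply (frameIso i).injective
  rw [frameIso_sub i hi, RelIso.apply_symm_apply, RelIso.apply_symm_apply, RelIso.apply_symm_apply]

/-- The transposition preserves the graph norm. [folklore] -/
theorem triNorm_triSwapIso (v : Site 2) : triNorm (triSwapIso v) = triNorm v := by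
  have h0 : (triSwapIso v) 0 = v 1 := by rw [triSwapIso_apply, transposeIso_apply_zero]
  have h1 : (triSwapIso v) 1 = v 0 := by rw [triSwapIso_apply, transposeIso_apply_one]
  have hv := triNorm_le_iff_lin.1 (le_refl (triNorm v))
  have hw := triNorm_le_iff_lin.1 (le_refl (triNorm (triSwapIso v)))
  rw [h0, h1] at hw
  exact le_antisymm (triNorm_le_iff_lin.2 (by rw [h0, h1]; omega)) (triNorm_le_iff_lin.2 (by omega))

/-- The frames preserve the graph norm. [folklore] -/
theorem triNorm_frameIso (i : ℕ) (hi : i < 6) (v : Site 2) : triNorm (frameIso i v) = triNorm v := by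
  interval_cases i
  · rfl
  · exact triNorm_rot 1 v
  · exact triNorm_triSwapIso v
  · exact triNorm_neg v
  · exact triNorm_rot 4 v
  · show triNorm (triNegIso (triSwapIso v)) = triNorm v
    rw [triNegIso_apply, triNorm_neg, triNorm_triSwapIso]

/-- The inverse frames preserve the graph norm. [folklore] -/
theorem triNorm_frameIso_symm (i : ℕ) (hi : i < 6) (v : Site 2) : triNorm ((frameIso i).symm v) = triNorm v := by
  conv_rhs => rw [← (frameIso i).apply_symm_apply v]
  rw [triNorm_frameIso i hi]

/-- **Every site lies on the right side of some frame**: `((frameIso i)⁻¹ y)₀ = |y|_𝕋` for some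
`i < 6` (the six linear forms `y₀, y₀+y₁, y₁, -y₀, -(y₀+y₁), -y₁`). [folklore] -/
theorem exists_frame_symm_apply_zero_eq (y : Site 2) : ∃ i < 6, ((frameIso i).symm y) 0 = triNorm y := by
  have key : ∀ i : ℕ, i < 6 → ∀ w : Site 2, (frameIso i w = y) → ∃ i < 6, ((frameIso i).symm y) 0 = w 0 := by
    intro i hi w hw
    exact ⟨i, hi, by rw [← hw, RelIso.symm_apply_apply]⟩
  obtain ⟨f0a, f0b, f1a, f1b, f2a, f2b, f3a, f3b, f4a, f4b, f5a, f5b⟩ := frameIso_apply_formula y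
  have hn := triNorm_eq_max y
  have hcases : triNorm y = y 0 ∨ triNorm y = y 0 + y 1 ∨ triNorm y = y 1 ∨ triNorm y = -y 0 ∨
      triNorm y = -(y 0 + y 1) ∨ triNorm y = -y 1 := by
    have hle := hn.ge
    have hge := hn.le
    simp only [max_le_iff] at hle
    simp only [le_max_iff] at hge
    omega
  -- candidate preimages, by explicit coordinates
  rcases hcases with h | h | h | h | h | h
  · exact ⟨0, by norm_num, by rw [h]; rfl⟩
  · -- `ρ w = y` with `w = (y₀ + y₁, -y₀)`
    obtain ⟨i, hi, e⟩ := key 1 (by norm_num) ![y 0 + y 1, -y 0] (by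
      obtain ⟨-, -, g1a, g1b, -⟩ := frameIso_apply_formula (![y 0 + y 1, -y 0] : Site 2)
      refine Site.eq_iff_two.2 ⟨?_, ?_⟩
      · rw [g1a, site_mk_apply_one]; ring
      · rw [g1b, site_mk_apply_zero, site_mk_apply_one]; ring)
    exact ⟨i, hi, by rw [e, site_mk_apply_zero, h]⟩
  · obtain ⟨i, hi, e⟩ := key 2 (by norm_num) ![y 1, y 0] (by
      obtain ⟨-, -, -, -, g2a, g2b, -⟩ := frameIso_apply_formula (![y 1, y 0] : Site 2)
      exact Site.eq_iff_two.2 ⟨by rw [g2a, site_mk_apply_one], by rw [g2b, site_mk_apply_zero]⟩)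
    exact ⟨i, hi, by rw [e, site_mk_apply_zero, h]⟩
  · obtain ⟨i, hi, e⟩ := key 3 (by norm_num) ![-y 0, -y 1] (by
      obtain ⟨-, -, -, -, -, -, g3a, g3b, -⟩ := frameIso_apply_formula (![-y 0, -y 1] : Site 2)
      exact Site.eq_iff_two.2 ⟨by rw [g3a, site_mk_apply_zero]; ring, by rw [g3b, site_mk_apply_one]; ring⟩)
    exact ⟨i, hi, by rw [e, site_mk_apply_zero, h]⟩
  · -- `ρ⁴ w = y` with `w = (-(y₀ + y₁), y₀)`
    obtain ⟨i, hi, e⟩ := key 4 (by norm_num) ![-(y 0 + y 1), y 0] (by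
      obtain ⟨-, -, -, -, -, -, -, -, g4a, g4b, -⟩ := frameIso_apply_formula (![-(y 0 + y 1), y 0] : Site 2)
      refine Site.eq_iff_two.2 ⟨?_, ?_⟩
      · rw [g4a, site_mk_apply_one]
      · rw [g4b, site_mk_apply_zero, site_mk_apply_one]; ring)
    exact ⟨i, hi, by rw [e, site_mk_apply_zero, h]⟩
  · obtain ⟨i, hi, e⟩ := key 5 (by norm_num) ![-y 1, -y 0] (by
      obtain ⟨-, -, -, -, -, -, -, -, -, -, g5a, g5b⟩ := frameIso_apply_formula (![-y 1, -y 0] : Site 2)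
      exact Site.eq_iff_two.2 ⟨by rw [g5a, site_mk_apply_one]; ring, by rw [g5b, site_mk_apply_zero]; ring⟩)
    exact ⟨i, hi, by rw [e, site_mk_apply_zero, h]⟩

/-! ### Framed configurations -/

/-- **The configuration read in the `i`-th frame**: `frameConfig i ω = {v | frameIso i v ∈ ω}`. [cite: Nolin2008, §4.4 (arXiv 0711.4948: proof of Thm. 10)] -/
def frameConfig (i : ℕ) (ω : SiteConfig (Site 2)) : SiteConfig (Site 2) :=
  SiteConfig.relabel (frameIso i).symm.toEquiv ω

/-- Membership in the framed configuration. [folklore] -/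
@[simp] theorem mem_frameConfig {i : ℕ} {ω : SiteConfig (Site 2)} {v : Site 2} :
    v ∈ frameConfig i ω ↔ frameIso i v ∈ ω := by
  rw [frameConfig, SiteConfig.mem_relabel_iff]; rfl

/-- Framing commutes with colour exchange. [folklore] -/
theorem frameConfig_compl (i : ℕ) (ω : SiteConfig (Site 2)) : (frameConfig i ω)ᶜ = frameConfig i ωᶜ :=
  SiteConfig.compl_relabel _ ω

/-- **`P_p` is invariant under the frames.** [folklore] -/
theorem real_preimage_frameConfig (p : unitInterval) (i : ℕ) (E : Set (SiteConfig (Site 2))) :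
    (triSitePercolation p).real (frameConfig i ⁻¹' E) = (triSitePercolation p).real E := by
  unfold triSitePercolation
  exact sitePercolation_real_preimage_relabel _ p E

/-- **Paths in the framed configuration**: a path of colour `b` inside `A` is carried by
`(frameIso i)⁻¹` to a path of colour `b` of `frameConfig i ω` inside `(frameIso i)⁻¹(A)`. [folklore] -/
theorem pathIn_frameConfig (i : ℕ) {A : Set (Site 2)} {ω : SiteConfig (Site 2)} {b : Bool} {x y : Site 2}
    (h : PathIn triGraph (A ∩ {v | v ∈ ω ↔ b}) x y) :
    PathIn triGraph (((frameIso i).symm '' A) ∩ {v | v ∈ frameConfig i ω ↔ b}) ((frameIso i).symm x) ((frameIso i).symm y) := by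
  refine (pathIn_map_iso (frameIso i).symm h).mono ?_
  rintro w ⟨v, ⟨hv, hvω⟩, rfl⟩
  refine ⟨⟨v, hv, rfl⟩, ?_⟩
  simp only [Set.mem_setOf_eq, mem_frameConfig] at hvω ⊢
  rw [show ((frameIso i).symm : triGraph ≃g triGraph) v = (frameIso i).symm v from rfl, RelIso.apply_symm_apply]
  exact hvω

/-- **Back to the original frame**: a path of colour `b` of `frameConfig i ω` inside `A` is carried
by `frameIso i` to a path of colour `b` of `ω` inside `frameIso i '' A`. [folklore] -/
theorem pathIn_of_frameConfig (i : ℕ) {A : Set (Site 2)} {ω : SiteConfig (Site 2)} {b : Bool} {x y : Site 2}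
    (h : PathIn triGraph (A ∩ {v | v ∈ frameConfig i ω ↔ b}) x y) :
    PathIn triGraph ((frameIso i '' A) ∩ {v | v ∈ ω ↔ b}) (frameIso i x) (frameIso i y) := by
  refine (pathIn_map_iso (frameIso i) h).mono ?_
  rintro w ⟨v, ⟨hv, hvω⟩, rfl⟩
  refine ⟨⟨v, hv, rfl⟩, ?_⟩
  simp only [Set.mem_setOf_eq, mem_frameConfig] at hvω ⊢
  exact hvω

/-! ### The good event in the frames -/

/-- **Nothing fails around `∂Λ_m`, framed version**: in each of the twelve framed /
colour-exchanged configurations `frameConfig i ω`, `(frameConfig i ω)ᶜ` (`i < 6`) there is no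
failure at the inner side `1` and both corner guards are present. [cite: Nolin2008, §4.4 (arXiv 0711.4948: proof of Thm. 10, internal extremities)] -/
def InGoodF (m T k₀ K R₀ Kg : ℕ) (ω : SiteConfig (Site 2)) : Prop :=
  ∀ i < 6,
    (¬ InFail m T k₀ K R₀ (frameConfig i ω) ∧ InGuard R₀ Kg ![(m : ℤ), -(m : ℤ)] (frameConfig i ω) ∧
        InGuard R₀ Kg ![(m : ℤ), 0] (frameConfig i ω)) ∧
      (¬ InFail m T k₀ K R₀ (frameConfig i ω)ᶜ ∧ InGuard R₀ Kg ![(m : ℤ), -(m : ℤ)] (frameConfig i ω)ᶜ ∧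
        InGuard R₀ Kg ![(m : ℤ), 0] (frameConfig i ω)ᶜ)

/-- Off `InGoodF`, one of the twelve framed configurations is bad. [folklore] -/
theorem not_inGoodF_subset (m T k₀ K R₀ Kg : ℕ) :
    {ω : SiteConfig (Site 2) | ¬ InGoodF m T k₀ K R₀ Kg ω} ⊆
      ⋃ i ∈ Finset.range 6, (frameConfig i ⁻¹' inBad m T k₀ K R₀ Kg ∪ frameConfig i ⁻¹' (compl ⁻¹' inBad m T k₀ K R₀ Kg)) := by
  intro ω hω
  simp only [Set.mem_setOf_eq, InGoodF, not_forall] at hω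
  obtain ⟨i, hi, h⟩ := hω
  simp only [Set.mem_iUnion, Set.mem_union, Set.mem_preimage, Finset.mem_range]
  refine ⟨i, hi, ?_⟩
  by_contra hno
  simp only [not_or] at hno
  obtain ⟨h1, h2⟩ := hno
  simp only [inBad, Set.mem_setOf_eq, not_or, not_not] at h1 h2
  exact h ⟨⟨h1.1, h1.2.1, h1.2.2⟩, ⟨h2.1, h2.2.1, h2.2.2⟩⟩

/-- **Nothing fails around `∂Λ_m` (framed) except with small probability**: for `m ≥ 8`,
`k₀, R₀ ≥ 1` and `2 k_j + 1 ≤ R₀` (`j < K`),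
`P(¬ InGoodF m T k₀ K R₀ Kg) ≤ 12 · ((1 - c⁵)^{T+1} + T (1 - c_F²)^K + 2 (1 - c_F²)^{Kg})`. [cite: Nolin2008, §4.4 Lemma 15 and Thm. 11 (proof) (arXiv 0711.4948: Lemma 14 (4.20), Thm. 10)] -/
theorem real_not_inGoodF_le {cF c : ℝ} (hcF : 0 < cF)
    (hF : ∀ (z : Site 2) (k : ℕ), 1 ≤ k → cF ≤ (triSitePercolation half).real (triFrameAt z k))
    (hrsw : ∀ n : ℕ, 1 ≤ ⌊(24 : ℝ) * n⌋₊ → c ≤ triLRCrossingProb half ⌊(24 : ℝ) * n⌋₊ n) (hc : 0 ≤ c)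
    {m T k₀ K R₀ Kg : ℕ} (hm : 8 ≤ m) (hk₀ : 1 ≤ k₀) (hR₀ : 1 ≤ R₀) (hKR : ∀ j < K, 2 * trapScale k₀ j + 1 ≤ R₀) :
    (triSitePercolation half).real {ω | ¬ InGoodF m T k₀ K R₀ Kg ω} ≤
      12 * ((1 - c ^ 5) ^ (T + 1) + T * (1 - cF ^ 2) ^ K + 2 * (1 - cF ^ 2) ^ Kg) := by
  set B := inBad m T k₀ K R₀ Kg with hB
  set ε := (1 - c ^ 5) ^ (T + 1) + T * (1 - cF ^ 2) ^ K + 2 * (1 - cF ^ 2) ^ Kg with hε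
  have hbad : (triSitePercolation half).real B ≤ ε := real_inBad_le hcF hF hrsw hc hm hk₀ hR₀ hKR
  have hrot : ∀ i : ℕ, (triSitePercolation half).real (frameConfig i ⁻¹' B) ≤ ε := fun i => by
    rw [real_preimage_frameConfig]; exact hbad
  have hrotc : ∀ i : ℕ, (triSitePercolation half).real (frameConfig i ⁻¹' (compl ⁻¹' B)) ≤ ε := fun i => by
    rw [real_preimage_frameConfig]
    unfold triSitePercolation
    rw [sitePercolation_real_preimage_compl, symm_half]
    exact hbad
  calc (triSitePercolation half).real {ω | ¬ InGoodF m T k₀ K R₀ Kg ω}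
      ≤ (triSitePercolation half).real
          (⋃ i ∈ Finset.range 6, (frameConfig i ⁻¹' B ∪ frameConfig i ⁻¹' (compl ⁻¹' B))) :=
        measureReal_mono (not_inGoodF_subset m T k₀ K R₀ Kg) (measure_ne_top _ _)
    _ ≤ ∑ i ∈ Finset.range 6, (triSitePercolation half).real (frameConfig i ⁻¹' B ∪ frameConfig i ⁻¹' (compl ⁻¹' B)) :=
        measureReal_biUnion_finset_le _ _
    _ ≤ ∑ i ∈ Finset.range 6, (ε + ε) := Finset.sum_le_sum fun i _ =>
        (measureReal_union_le _ _).trans (add_le_add (hrot i) (hrotc i))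
    _ = 12 * ε := by rw [Finset.sum_const, Finset.card_range, nsmul_eq_mul]; push_cast; ring

/-! ### Two fenced arms in the frames -/

/-- The inverse frame of a region of sites of norm `≥ m` is such a region. [folklore] -/
theorem norm_le_of_mem_image_frame_symm {m : ℕ} {i : ℕ} (hi : i < 6) {A : Set (Site 2)}
    (hA : ∀ v ∈ A, (m : ℤ) ≤ triNorm v) : ∀ v ∈ (frameIso i).symm '' A, (m : ℤ) ≤ triNorm v := by
  rintro _ ⟨v, hv, rfl⟩
  rw [show ((frameIso i).symm : triGraph ≃g triGraph) v = (frameIso i).symm v from rfl, triNorm_frameIso_symm i hi]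
  exact hA v hv

/-- The inverse frame of a region containing the annulus `{m ≤ |v| ≤ 2m}` contains `HA(m)`. [folklore] -/
theorem haSet_subset_image_frame_symm {m : ℕ} {i : ℕ} (hi : i < 6) {A : Set (Site 2)}
    (hA : triAnnSet m (2 * m) ⊆ A) : haSet m ⊆ (frameIso i).symm '' A := by
  intro v hv
  rw [mem_haSet] at hv
  refine ⟨frameIso i v, hA ?_, (frameIso i).symm_apply_apply v⟩
  rw [mem_triAnnSet, triNorm_frameIso i hi]
  push_cast
  exact ⟨hv.2.1, hv.2.2⟩

/-- **An arm leaves the right side of some frame** (general data): an `ω`-colour-`c` path inside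
`A` from a site `y` of `∂Λ_m` to a site `b` is, in some frame `i < 6`, a colour-`c` path of
`frameConfig i ω` inside `(frameIso i)⁻¹(A)` from a site of the right side (`y'₀ = m = |y'|`) to
`(frameIso i)⁻¹ b`. [cite: Nolin2008, §4.4 (arXiv 0711.4948: proof of Thm. 10)] -/
theorem exists_rightSide_pathIn_frameConfig {c : Bool} {m : ℕ} {A : Set (Site 2)} {ω : SiteConfig (Site 2)} {y b : Site 2}
    (hy : triNorm y = m) (hp : PathIn triGraph (A ∩ {v | v ∈ ω ↔ c}) y b) :
    ∃ i < 6, ∃ y' : Site 2, y' 0 = m ∧ triNorm y' = m ∧ triNorm ((frameIso i).symm b) = triNorm b ∧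
      PathIn triGraph (((frameIso i).symm '' A) ∩ {v | v ∈ frameConfig i ω ↔ c}) y' ((frameIso i).symm b) := by
  obtain ⟨i, hi, hi0⟩ := exists_frame_symm_apply_zero_eq y
  exact ⟨i, hi, (frameIso i).symm y, by rw [hi0, hy], by rw [triNorm_frameIso_symm i hi, hy],
    triNorm_frameIso_symm i hi b, pathIn_frameConfig i hp⟩

/-- **Both arms are fenced in the frames**: let `A_o`, `A_c` be regions of sites of norm `≥ m`
containing the annulus `{m ≤ |v| ≤ 2m}`; an open path of `A_o` from `∂Λ_m` to a site of norm
`> 2m`, a closed path of `A_c` from `∂Λ_m` to a site of norm `> 2m`, and `InGoodF` give a fenced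
open arm in some frame `io` (region `(frameIso io)⁻¹(A_o)`, far end `(frameIso io)⁻¹ b_o`) and a
fenced closed arm in some frame `ic` (`m ≥ 5`, `R₀ ≥ 2`, `4 · R₀ 32^i < m` for `i < Kg`). [cite: Nolin2008, §4.4 (arXiv 0711.4948: proof of Thm. 10, internal extremities)] -/
theorem exists_two_intFencedArm_frames {m T k₀ K R₀ Kg : ℕ} (hm : 5 ≤ m) (hR₀ : 2 ≤ R₀)
    (hRg : ∀ i < Kg, 4 * trapScale R₀ i < m) {ω : SiteConfig (Site 2)} (hgood : InGoodF m T k₀ K R₀ Kg ω)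
    {Ao Ac : Set (Site 2)} (hAo : ∀ v ∈ Ao, (m : ℤ) ≤ triNorm v) (hAo' : triAnnSet m (2 * m) ⊆ Ao)
    (hAc : ∀ v ∈ Ac, (m : ℤ) ≤ triNorm v) (hAc' : triAnnSet m (2 * m) ⊆ Ac)
    {yo bo yc bc : Site 2} (hyo : triNorm yo = m) (hbo : 2 * (m : ℤ) < triNorm bo) (hpo : PathIn triGraph (Ao ∩ ω) yo bo)
    (hyc : triNorm yc = m) (hbc : 2 * (m : ℤ) < triNorm bc) (hpc : PathIn triGraph (Ac ∩ ωᶜ) yc bc) :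
    ∃ io < 6, ∃ ic < 6, (∃ Fo : IntFencedArm m ((frameIso io).symm '' Ao) k₀ K R₀ (frameConfig io ω), Fo.b = (frameIso io).symm bo) ∧
      ∃ Fc : IntFencedArm m ((frameIso ic).symm '' Ac) k₀ K R₀ (frameConfig ic ω)ᶜ, Fc.b = (frameIso ic).symm bc := by
  have hpo' : PathIn triGraph (Ao ∩ {v | v ∈ ω ↔ true}) yo bo := hpo.mono fun v hv => ⟨hv.1, by simpa using hv.2⟩
  have hpc' : PathIn triGraph (Ac ∩ {v | v ∈ ω ↔ false}) yc bc := hpc.mono fun v hv => ⟨hv.1, by simpa using hv.2⟩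
  obtain ⟨io, hio, yo', hyo0, hyon, hbon, Po⟩ := exists_rightSide_pathIn_frameConfig hyo hpo'
  obtain ⟨ic, hic, yc', hyc0, hycn, hbcn, Pc⟩ := exists_rightSide_pathIn_frameConfig hyc hpc'
  have Po' : PathIn triGraph (((frameIso io).symm '' Ao) ∩ frameConfig io ω) yo' ((frameIso io).symm bo) :=
    Po.mono fun v hv => ⟨hv.1, by simpa using hv.2⟩
  have Pc' : PathIn triGraph (((frameIso ic).symm '' Ac) ∩ (frameConfig ic ω)ᶜ) yc' ((frameIso ic).symm bc) :=
    Pc.mono fun v hv => ⟨hv.1, by simpa using hv.2⟩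
  obtain ⟨⟨hfo, hdo, huo⟩, -⟩ := hgood io hio
  obtain ⟨-, ⟨hfc, hdc, huc⟩⟩ := hgood ic hic
  exact ⟨io, hio, ic, hic,
    exists_intFencedArm_b_eq hm (norm_le_of_mem_image_frame_symm hio hAo) (haSet_subset_image_frame_symm hio hAo') hR₀ hRg
      hfo hdo huo hyo0 hyon (by rw [hbon]; exact hbo) Po',
    exists_intFencedArm_b_eq hm (norm_le_of_mem_image_frame_symm hic hAc) (haSet_subset_image_frame_symm hic hAc') hR₀ hRg
      hfc hdc huc hyc0 hycn (by rw [hbcn]; exact hbc) Pc'⟩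

/-! ### Compatibility of the inner free spaces in the frames -/

/-- Different frames separate the interior regions: the frame `0` against the others (pure
arithmetic, see `frameIso_apply_ne_of_intRegion`). [folklore] -/
theorem frameIso_apply_ne_of_intRegion_0 {m R₀ ko kc : ℕ} {tO tC : ℤ} (hKo : 64 * ko < m) (hKc : 64 * kc < m)
    (hRo : 2 * (ko : ℤ) + 2 ≤ R₀) (hRc : 2 * (kc : ℤ) + 2 ≤ R₀)
    (hto : -(m : ℤ) + R₀ ≤ tO ∧ tO ≤ -(R₀ : ℤ)) (htc : -(m : ℤ) + R₀ ≤ tC ∧ tC ≤ -(R₀ : ℤ))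
    {v w : Site 2} (hv : 0 ≤ v 0 ∧ triNorm v < m ∧ tO < v 1 ∧ v 1 ≤ tO + (2 * ko + 1) ∧ (m : ℤ) - (2 * ko + 1) ≤ v 0)
    (hw : 0 ≤ w 0 ∧ triNorm w < m ∧ tC < w 1 ∧ w 1 ≤ tC + (2 * kc + 1) ∧ (m : ℤ) - (2 * kc + 1) ≤ w 0)
    {ic : ℕ} (hic : ic < 6) (hne : 0 ≠ ic) (heq : frameIso 0 v = frameIso ic w) : False := by
  obtain ⟨hv0, hvn, hv1, hv2, hv3⟩ := hv
  obtain ⟨hw0, hwn, hw1, hw2, hw3⟩ := hw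
  have hvlt := triNorm_lt_iff_lin.1 hvn
  have hwlt := triNorm_lt_iff_lin.1 hwn
  have hKo' : 64 * (ko : ℤ) < m := by exact_mod_cast hKo
  have hKc' : 64 * (kc : ℤ) < m := by exact_mod_cast hKc
  have heq' := Site.eq_iff_two.1 heq
  obtain ⟨f0a, f0b, f1a, f1b, f2a, f2b, f3a, f3b, f4a, f4b, f5a, f5b⟩ := frameIso_apply_formula v
  obtain ⟨g0a, g0b, g1a, g1b, g2a, g2b, g3a, g3b, g4a, g4b, g5a, g5b⟩ := frameIso_apply_formula w
  clear hvn hwn heq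
  interval_cases ic <;> omega

/-- Different frames separate the interior regions: the frame `1` against the others (pure
arithmetic, see `frameIso_apply_ne_of_intRegion`). [folklore] -/
theorem frameIso_apply_ne_of_intRegion_1 {m R₀ ko kc : ℕ} {tO tC : ℤ} (hKo : 64 * ko < m) (hKc : 64 * kc < m)
    (hRo : 2 * (ko : ℤ) + 2 ≤ R₀) (hRc : 2 * (kc : ℤ) + 2 ≤ R₀)
    (hto : -(m : ℤ) + R₀ ≤ tO ∧ tO ≤ -(R₀ : ℤ)) (htc : -(m : ℤ) + R₀ ≤ tC ∧ tC ≤ -(R₀ : ℤ))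
    {v w : Site 2} (hv : 0 ≤ v 0 ∧ triNorm v < m ∧ tO < v 1 ∧ v 1 ≤ tO + (2 * ko + 1) ∧ (m : ℤ) - (2 * ko + 1) ≤ v 0)
    (hw : 0 ≤ w 0 ∧ triNorm w < m ∧ tC < w 1 ∧ w 1 ≤ tC + (2 * kc + 1) ∧ (m : ℤ) - (2 * kc + 1) ≤ w 0)
    {ic : ℕ} (hic : ic < 6) (hne : 1 ≠ ic) (heq : frameIso 1 v = frameIso ic w) : False := by
  obtain ⟨hv0, hvn, hv1, hv2, hv3⟩ := hv
  obtain ⟨hw0, hwn, hw1, hw2, hw3⟩ := hw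
  have hvlt := triNorm_lt_iff_lin.1 hvn
  have hwlt := triNorm_lt_iff_lin.1 hwn
  have hKo' : 64 * (ko : ℤ) < m := by exact_mod_cast hKo
  have hKc' : 64 * (kc : ℤ) < m := by exact_mod_cast hKc
  have heq' := Site.eq_iff_two.1 heq
  obtain ⟨f0a, f0b, f1a, f1b, f2a, f2b, f3a, f3b, f4a, f4b, f5a, f5b⟩ := frameIso_apply_formula v
  obtain ⟨g0a, g0b, g1a, g1b, g2a, g2b, g3a, g3b, g4a, g4b, g5a, g5b⟩ := frameIso_apply_formula w
  clear hvn hwn heq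
  interval_cases ic <;> omega

/-- Different frames separate the interior regions: the frame `2` against the others (pure
arithmetic, see `frameIso_apply_ne_of_intRegion`). [folklore] -/
theorem frameIso_apply_ne_of_intRegion_2 {m R₀ ko kc : ℕ} {tO tC : ℤ} (hKo : 64 * ko < m) (hKc : 64 * kc < m)
    (hRo : 2 * (ko : ℤ) + 2 ≤ R₀) (hRc : 2 * (kc : ℤ) + 2 ≤ R₀)
    (hto : -(m : ℤ) + R₀ ≤ tO ∧ tO ≤ -(R₀ : ℤ)) (htc : -(m : ℤ) + R₀ ≤ tC ∧ tC ≤ -(R₀ : ℤ))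
    {v w : Site 2} (hv : 0 ≤ v 0 ∧ triNorm v < m ∧ tO < v 1 ∧ v 1 ≤ tO + (2 * ko + 1) ∧ (m : ℤ) - (2 * ko + 1) ≤ v 0)
    (hw : 0 ≤ w 0 ∧ triNorm w < m ∧ tC < w 1 ∧ w 1 ≤ tC + (2 * kc + 1) ∧ (m : ℤ) - (2 * kc + 1) ≤ w 0)
    {ic : ℕ} (hic : ic < 6) (hne : 2 ≠ ic) (heq : frameIso 2 v = frameIso ic w) : False := by
  obtain ⟨hv0, hvn, hv1, hv2, hv3⟩ := hv
  obtain ⟨hw0, hwn, hw1, hw2, hw3⟩ := hw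
  have hvlt := triNorm_lt_iff_lin.1 hvn
  have hwlt := triNorm_lt_iff_lin.1 hwn
  have hKo' : 64 * (ko : ℤ) < m := by exact_mod_cast hKo
  have hKc' : 64 * (kc : ℤ) < m := by exact_mod_cast hKc
  have heq' := Site.eq_iff_two.1 heq
  obtain ⟨f0a, f0b, f1a, f1b, f2a, f2b, f3a, f3b, f4a, f4b, f5a, f5b⟩ := frameIso_apply_formula v
  obtain ⟨g0a, g0b, g1a, g1b, g2a, g2b, g3a, g3b, g4a, g4b, g5a, g5b⟩ := frameIso_apply_formula w
  clear hvn hwn heq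
  interval_cases ic <;> omega

/-- Different frames separate the interior regions: the frame `3` against the others (pure
arithmetic, see `frameIso_apply_ne_of_intRegion`). [folklore] -/
theorem frameIso_apply_ne_of_intRegion_3 {m R₀ ko kc : ℕ} {tO tC : ℤ} (hKo : 64 * ko < m) (hKc : 64 * kc < m)
    (hRo : 2 * (ko : ℤ) + 2 ≤ R₀) (hRc : 2 * (kc : ℤ) + 2 ≤ R₀)
    (hto : -(m : ℤ) + R₀ ≤ tO ∧ tO ≤ -(R₀ : ℤ)) (htc : -(m : ℤ) + R₀ ≤ tC ∧ tC ≤ -(R₀ : ℤ))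
    {v w : Site 2} (hv : 0 ≤ v 0 ∧ triNorm v < m ∧ tO < v 1 ∧ v 1 ≤ tO + (2 * ko + 1) ∧ (m : ℤ) - (2 * ko + 1) ≤ v 0)
    (hw : 0 ≤ w 0 ∧ triNorm w < m ∧ tC < w 1 ∧ w 1 ≤ tC + (2 * kc + 1) ∧ (m : ℤ) - (2 * kc + 1) ≤ w 0)
    {ic : ℕ} (hic : ic < 6) (hne : 3 ≠ ic) (heq : frameIso 3 v = frameIso ic w) : False := by
  obtain ⟨hv0, hvn, hv1, hv2, hv3⟩ := hv
  obtain ⟨hw0, hwn, hw1, hw2, hw3⟩ := hw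
  have hvlt := triNorm_lt_iff_lin.1 hvn
  have hwlt := triNorm_lt_iff_lin.1 hwn
  have hKo' : 64 * (ko : ℤ) < m := by exact_mod_cast hKo
  have hKc' : 64 * (kc : ℤ) < m := by exact_mod_cast hKc
  have heq' := Site.eq_iff_two.1 heq
  obtain ⟨f0a, f0b, f1a, f1b, f2a, f2b, f3a, f3b, f4a, f4b, f5a, f5b⟩ := frameIso_apply_formula v
  obtain ⟨g0a, g0b, g1a, g1b, g2a, g2b, g3a, g3b, g4a, g4b, g5a, g5b⟩ := frameIso_apply_formula w
  clear hvn hwn heq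
  interval_cases ic <;> omega

/-- Different frames separate the interior regions: the frame `4` against the others (pure
arithmetic, see `frameIso_apply_ne_of_intRegion`). [folklore] -/
theorem frameIso_apply_ne_of_intRegion_4 {m R₀ ko kc : ℕ} {tO tC : ℤ} (hKo : 64 * ko < m) (hKc : 64 * kc < m)
    (hRo : 2 * (ko : ℤ) + 2 ≤ R₀) (hRc : 2 * (kc : ℤ) + 2 ≤ R₀)
    (hto : -(m : ℤ) + R₀ ≤ tO ∧ tO ≤ -(R₀ : ℤ)) (htc : -(m : ℤ) + R₀ ≤ tC ∧ tC ≤ -(R₀ : ℤ))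
    {v w : Site 2} (hv : 0 ≤ v 0 ∧ triNorm v < m ∧ tO < v 1 ∧ v 1 ≤ tO + (2 * ko + 1) ∧ (m : ℤ) - (2 * ko + 1) ≤ v 0)
    (hw : 0 ≤ w 0 ∧ triNorm w < m ∧ tC < w 1 ∧ w 1 ≤ tC + (2 * kc + 1) ∧ (m : ℤ) - (2 * kc + 1) ≤ w 0)
    {ic : ℕ} (hic : ic < 6) (hne : 4 ≠ ic) (heq : frameIso 4 v = frameIso ic w) : False := by
  obtain ⟨hv0, hvn, hv1, hv2, hv3⟩ := hv
  obtain ⟨hw0, hwn, hw1, hw2, hw3⟩ := hw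
  have hvlt := triNorm_lt_iff_lin.1 hvn
  have hwlt := triNorm_lt_iff_lin.1 hwn
  have hKo' : 64 * (ko : ℤ) < m := by exact_mod_cast hKo
  have hKc' : 64 * (kc : ℤ) < m := by exact_mod_cast hKc
  have heq' := Site.eq_iff_two.1 heq
  obtain ⟨f0a, f0b, f1a, f1b, f2a, f2b, f3a, f3b, f4a, f4b, f5a, f5b⟩ := frameIso_apply_formula v
  obtain ⟨g0a, g0b, g1a, g1b, g2a, g2b, g3a, g3b, g4a, g4b, g5a, g5b⟩ := frameIso_apply_formula w
  clear hvn hwn heq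
  interval_cases ic <;> omega

/-- Different frames separate the interior regions: the frame `5` against the others (pure
arithmetic, see `frameIso_apply_ne_of_intRegion`). [folklore] -/
theorem frameIso_apply_ne_of_intRegion_5 {m R₀ ko kc : ℕ} {tO tC : ℤ} (hKo : 64 * ko < m) (hKc : 64 * kc < m)
    (hRo : 2 * (ko : ℤ) + 2 ≤ R₀) (hRc : 2 * (kc : ℤ) + 2 ≤ R₀)
    (hto : -(m : ℤ) + R₀ ≤ tO ∧ tO ≤ -(R₀ : ℤ)) (htc : -(m : ℤ) + R₀ ≤ tC ∧ tC ≤ -(R₀ : ℤ))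
    {v w : Site 2} (hv : 0 ≤ v 0 ∧ triNorm v < m ∧ tO < v 1 ∧ v 1 ≤ tO + (2 * ko + 1) ∧ (m : ℤ) - (2 * ko + 1) ≤ v 0)
    (hw : 0 ≤ w 0 ∧ triNorm w < m ∧ tC < w 1 ∧ w 1 ≤ tC + (2 * kc + 1) ∧ (m : ℤ) - (2 * kc + 1) ≤ w 0)
    {ic : ℕ} (hic : ic < 6) (hne : 5 ≠ ic) (heq : frameIso 5 v = frameIso ic w) : False := by
  obtain ⟨hv0, hvn, hv1, hv2, hv3⟩ := hv
  obtain ⟨hw0, hwn, hw1, hw2, hw3⟩ := hw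
  have hvlt := triNorm_lt_iff_lin.1 hvn
  have hwlt := triNorm_lt_iff_lin.1 hwn
  have hKo' : 64 * (ko : ℤ) < m := by exact_mod_cast hKo
  have hKc' : 64 * (kc : ℤ) < m := by exact_mod_cast hKc
  have heq' := Site.eq_iff_two.1 heq
  obtain ⟨f0a, f0b, f1a, f1b, f2a, f2b, f3a, f3b, f4a, f4b, f5a, f5b⟩ := frameIso_apply_formula v
  obtain ⟨g0a, g0b, g1a, g1b, g2a, g2b, g3a, g3b, g4a, g4b, g5a, g5b⟩ := frameIso_apply_formula w
  clear hvn hwn heq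
  interval_cases ic <;> omega

/-- **Different frames: the coordinates separate** (pure arithmetic). For `io ≠ ic` (`< 6`), a
point `v` of an interior region in the frame `io` (tip `(m, t)`, `-m + R₀ ≤ t ≤ -R₀`, scale `k`:
`0 ≤ v₀`, `|v| < m`, `t < v₁ ≤ t + 2k + 1`, `m - (2k+1) ≤ v₀`) and a point `w` of one in the frame
`ic` never satisfy `frameIso io v = frameIso ic w` (`64k < m`, `2k + 2 ≤ R₀`). [folklore] -/
theorem frameIso_apply_ne_of_intRegion {m R₀ ko kc : ℕ} {tO tC : ℤ} (hKo : 64 * ko < m) (hKc : 64 * kc < m)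
    (hRo : 2 * (ko : ℤ) + 2 ≤ R₀) (hRc : 2 * (kc : ℤ) + 2 ≤ R₀)
    (hto : -(m : ℤ) + R₀ ≤ tO ∧ tO ≤ -(R₀ : ℤ)) (htc : -(m : ℤ) + R₀ ≤ tC ∧ tC ≤ -(R₀ : ℤ))
    {v w : Site 2} (hv : 0 ≤ v 0 ∧ triNorm v < m ∧ tO < v 1 ∧ v 1 ≤ tO + (2 * ko + 1) ∧ (m : ℤ) - (2 * ko + 1) ≤ v 0)
    (hw : 0 ≤ w 0 ∧ triNorm w < m ∧ tC < w 1 ∧ w 1 ≤ tC + (2 * kc + 1) ∧ (m : ℤ) - (2 * kc + 1) ≤ w 0)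
    {io ic : ℕ} (hio : io < 6) (hic : ic < 6) (hne : io ≠ ic) (heq : frameIso io v = frameIso ic w) : False := by
  interval_cases io
  · exact frameIso_apply_ne_of_intRegion_0 hKo hKc hRo hRc hto htc hv hw hic hne heq
  · exact frameIso_apply_ne_of_intRegion_1 hKo hKc hRo hRc hto htc hv hw hic hne heq
  · exact frameIso_apply_ne_of_intRegion_2 hKo hKc hRo hRc hto htc hv hw hic hne heq
  · exact frameIso_apply_ne_of_intRegion_3 hKo hKc hRo hRc hto htc hv hw hic hne heq
  · exact frameIso_apply_ne_of_intRegion_4 hKo hKc hRo hRc hto htc hv hw hic hne heq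
  · exact frameIso_apply_ne_of_intRegion_5 hKo hKc hRo hRc hto htc hv hw hic hne heq

/-- **Compatibility of the inner free spaces of the two arms (frames)**: for a fenced open arm
`Fo` in the frame `io` and a fenced closed arm `Fc` in the frame `ic` (regions of norms `≥ m`,
`64 k < m`, `2k + 2 ≤ R₀` for all scales, `io, ic < 6`), the interior regions
`frameIso io (intRegion Fo)` and `frameIso ic (intRegion Fc)` are disjoint: in the same frame by
the protection of the lower tip (`int_compatible_same₂`), in different frames by the explicit
coordinates of the frames and the margins (regions lie within `2k + 1 < R₀` rows above their tip,
tips at least `R₀` from the ends of their side, `|v| < m`; `frameIso_apply_ne_of_intRegion`). [cite: Nolin2008, §4.2 Def. 6–8 and §4.3 Prop. 12 (arXiv 0711.4948: Prop. 11)] -/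
theorem disjoint_intRegion_frames {m k₀ K R₀ : ℕ} {Ao Ac : Set (Site 2)}
    (hAo : ∀ v ∈ Ao, (m : ℤ) ≤ triNorm v) (hAc : ∀ v ∈ Ac, (m : ℤ) ≤ triNorm v) (hk₀ : 1 ≤ k₀)
    (hKm : ∀ j < K, 64 * trapScale k₀ j < m) (hKR : ∀ j < K, 2 * trapScale k₀ j + 2 ≤ R₀)
    {ω : SiteConfig (Site 2)} {io ic : ℕ} (hio : io < 6) (hic : ic < 6)
    (Fo : IntFencedArm m Ao k₀ K R₀ (frameConfig io ω)) (Fc : IntFencedArm m Ac k₀ K R₀ (frameConfig ic ω)ᶜ) :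
    Disjoint (frameIso io '' Fo.intRegion) (frameIso ic '' Fc.intRegion) := by
  rw [Set.disjoint_left]
  rintro _ ⟨v, hv, rfl⟩ ⟨w, hw, hvw⟩
  by_cases hsame : io = ic
  · subst hsame
    have hinj : w = v := (frameIso io).injective hvw
    subst hinj
    have hd := int_compatible_same₂ hAo hAc hk₀ hKm
      (fun u (hu : u ∈ (frameConfig io ω)ᶜ) (hu' : u ∈ frameConfig io ω) => hu hu')
      (fun u (hu : u ∈ frameConfig io ω) (hu' : u ∈ (frameConfig io ω)ᶜ) => hu' hu) Fo Fc
    exact Set.disjoint_left.1 hd hv hw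
  · have hzo := Fo.z_isIntJ
    have hzc := Fc.z_isIntJ
    rw [IntFencedArm.mem_intRegion] at hv hw
    rw [hzo.1] at hv
    rw [hzc.1] at hw
    exact frameIso_apply_ne_of_intRegion (hKm _ Fo.j_lt) (hKm _ Fc.j_lt) (by exact_mod_cast hKR _ Fo.j_lt)
      (by exact_mod_cast hKR _ Fc.j_lt) Fo.z_mid Fc.z_mid hv hw hio hic hsame hvw.symm

end Literature.Probability.Percolation
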